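import Mathlib.Analysis.Calculus.ContDiff.Comp
import Mathlib.Analysis.Calculus.ContDiff.Operations
import Mathlib.Analysis.Calculus.MeanValue
import HarnessLib

/-!
# Iterated derivatives depending on a parameter: joint smoothness and Lipschitz dependence

Analysis/Calculus support file (everything proved; theorems only, no definitions, no named facts).

For a jointly smooth `F : P × E → G` the iterated derivatives *in the second variable*,
`Φᵢ(p, y) = Dⁱ_y [F(p, ·)](y)`, are again jointly smooth in `(p, y)`
(`contDiffAt_iteratedFDeriv_parametric`, by induction on `i` through
`iteratedFDeriv_succ_eq_comp_left` and one parametric derivative, Mathlib's `ContDiffAt.fderiv`);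
consequently, on `K × L` with `K` convex compact and `L` compact inside the domain of smoothness,
they are Lipschitz in the parameter uniformly in the point (mean value inequality,
`exists_norm_sub_le_mul_norm_sub_of_contDiffOn`, `exists_norm_iteratedFDeriv_sub_le_parametric`), and
in particular **if `F(p₀, ·)` vanishes then `‖Dⁱ_y F(p, ·)(y)‖ ≤ C ‖p − p₀‖` for all `i ≤ k`,
`p ∈ K`, `y ∈ L`** (`exists_norm_iteratedFDeriv_le_parametric_of_eq_zero`). This is the calculus
behind estimates of the form "`‖g_{m,a} − g_{m₀,0}‖_{C^k(compact)} ≤ C(|m − m₀| + |a|)`" for explicit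
smooth families of tensors (e.g. Li–Mei, arXiv:2005.01249, proof of Prop. 4.1, p. 22, for the Kerr
family). Dieudonné, *Foundations of Modern Analysis* (1960), (8.9.1), (8.12.6) and (8.5.4).

## References

* J. Dieudonné, *Foundations of Modern Analysis* (1960), Ch. VIII, (8.5.4), (8.9.1), (8.12.6)
  (key `Dieudonne1960`).
-/

noncomputable section

open Set Filter Function Metric
open scoped Topology ContDiff

namespace Literature.Analysis.Calculus

variable {P : Type*} [NormedAddCommGroup P] [NormedSpace ℝ P]
  {E : Type*} [NormedAddCommGroup E] [NormedSpace ℝ E]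
  {G : Type*} [NormedAddCommGroup G] [NormedSpace ℝ G]

/-- **Joint regularity of parametric iterated derivatives (finite order).** If `F : P × E → G` is
`C^{N+i}` at every point of a set `U` (of pairs), then `(p, y) ↦ Dⁱ[F(p, ·)](y)` is `C^N` at
every point of `U`. Induction on `i`: `Dⁱ⁺¹ = curry ∘ D(Dⁱ)` (`iteratedFDeriv_succ_eq_comp_left`) and
one derivative with parameters (`ContDiffAt.fderiv`). Dieudonné 1960, (8.12.6), (8.9.1). [folklore] -/
theorem contDiffAt_iteratedFDeriv_parametric_nat {F : P × E → G} {U : Set (P × E)} (i N : ℕ)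
    (hF : ∀ q ∈ U, ContDiffAt ℝ (N + i : ℕ) F q) :
    ∀ q ∈ U, ContDiffAt ℝ N (fun q : P × E ↦ iteratedFDeriv ℝ i (fun z ↦ F (q.1, z)) q.2) q := by
  induction i generalizing N with
  | zero =>
    intro q hq
    have h : (fun q : P × E ↦ iteratedFDeriv ℝ 0 (fun z ↦ F (q.1, z)) q.2) =
        ⇑(continuousMultilinearCurryFin0 ℝ E G).symm.toContinuousLinearEquiv ∘ F := by
      funext q
      rfl
    rw [h, ContinuousLinearEquiv.comp_contDiffAt_iff]
    simpa using hF q hq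
  | succ i ih =>
    intro q hq
    -- the `i`-th derivative is `C^{N+1}` jointly (induction hypothesis at `N + 1`)
    have hF' : ∀ q ∈ U, ContDiffAt ℝ ((N + 1) + i : ℕ) F q := fun q hq ↦ by
      have e : (N + 1) + i = N + (i + 1) := by ring
      rw [e]
      exact hF q hq
    have hunc : ContDiffAt ℝ (N + 1 : ℕ)
        (uncurry fun (q : P × E) (z : E) ↦ iteratedFDeriv ℝ i (fun z' ↦ F (q.1, z')) z)
        (q, q.2) := by
      have e : (uncurry fun (q : P × E) (z : E) ↦ iteratedFDeriv ℝ i (fun z' ↦ F (q.1, z')) z) =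
          (fun r : P × E ↦ iteratedFDeriv ℝ i (fun z' ↦ F (r.1, z')) r.2) ∘
            fun r : (P × E) × E ↦ (r.1.1, r.2) := by
        funext r
        rfl
      rw [e]
      exact ContDiffAt.comp (q, q.2) (ih (N + 1) hF' (q.1, q.2) hq)
        ((contDiff_fst.comp contDiff_fst).prodMk contDiff_snd).contDiffAt
    -- one derivative in `z`, with the parameter `q`
    have hf' : ContDiffAt ℝ N (fun q : P × E ↦
        fderiv ℝ (fun z ↦ iteratedFDeriv ℝ i (fun z' ↦ F (q.1, z')) z) q.2) q :=
      hunc.fderiv contDiffAt_snd (by push_cast; exact le_rfl)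
    -- compose with the (linear isometric) currying
    have key : ContDiffAt ℝ N
        ((⇑((continuousMultilinearCurryLeftEquiv ℝ (fun _ : Fin (i + 1) ↦ E)
              G).symm.toContinuousLinearEquiv :
            (E →L[ℝ] E [×i]→L[ℝ] G) →L[ℝ] E [×(i + 1)]→L[ℝ] G)) ∘
          fun q : P × E ↦ fderiv ℝ (fun z ↦ iteratedFDeriv ℝ i (fun z' ↦ F (q.1, z')) z) q.2) q :=
      hf'.continuousLinearMap_comp _
    exact key

/-- **Joint smoothness of parametric iterated derivatives.** If `F : P × E → G` is `C^∞` at every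
point of a set `U`, then for every `i` the map `(p, y) ↦ Dⁱ[F(p, ·)](y)` is `C^∞` at every
point of `U`. Dieudonné 1960, (8.12.6). [folklore] -/
theorem contDiffAt_iteratedFDeriv_parametric {F : P × E → G} {U : Set (P × E)}
    (hF : ∀ q ∈ U, ContDiffAt ℝ ∞ F q) (i : ℕ) :
    ∀ q ∈ U, ContDiffAt ℝ ∞ (fun q : P × E ↦ iteratedFDeriv ℝ i (fun z ↦ F (q.1, z)) q.2) q :=
  fun q hq ↦ contDiffAt_infty.2 fun N ↦
    contDiffAt_iteratedFDeriv_parametric_nat i N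
      (fun q' hq' ↦ contDiffAt_infty.1 (hF q' hq') _) q hq

/-- **Uniform Lipschitz dependence on the parameter (mean value inequality).** Let `Φ : P × E → G`
be `C¹` on an open set `U ⊇ K × L` with `K ⊆ P` convex compact and `L ⊆ E` compact. Then there is
`C ≥ 0` with `‖Φ(p', y) − Φ(p, y)‖ ≤ C ‖p' − p‖` for all `p, p' ∈ K`, `y ∈ L` (`C` = the maximum of
`‖DΦ‖` on `K × L`; Dieudonné 1960, (8.5.4)). [folklore] -/
theorem exists_norm_sub_le_mul_norm_sub_of_contDiffOn {Φ : P × E → G} {U : Set (P × E)}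
    (hU : IsOpen U) (hΦ : ContDiffOn ℝ 1 Φ U) {K : Set P} (hK : IsCompact K) (hKc : Convex ℝ K)
    {L : Set E} (hL : IsCompact L) (hKL : K ×ˢ L ⊆ U) :
    ∃ C : ℝ, 0 ≤ C ∧ ∀ p ∈ K, ∀ p' ∈ K, ∀ y ∈ L, ‖Φ (p', y) - Φ (p, y)‖ ≤ C * ‖p' - p‖ := by
  obtain ⟨C₀, hC₀⟩ := (hK.prod hL).exists_bound_of_continuousOn
    ((hΦ.continuousOn_fderiv_of_isOpen hU le_rfl).mono hKL)
  refine ⟨max C₀ 0, le_max_right _ _, fun p hp p' hp' y hy ↦ ?_⟩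
  have hderiv : ∀ r ∈ K, HasFDerivWithinAt (fun r : P ↦ Φ (r, y))
      ((fderiv ℝ Φ (r, y)).comp (ContinuousLinearMap.inl ℝ P E)) K r := by
    intro r hr
    have hry : (r, y) ∈ U := hKL (mk_mem_prod hr hy)
    have hd : DifferentiableAt ℝ Φ (r, y) :=
      (hΦ.differentiableOn one_ne_zero).differentiableAt (hU.mem_nhds hry)
    exact (hd.hasFDerivAt.comp r (hasFDerivAt_prodMk_left r y)).hasFDerivWithinAt
  have hbound : ∀ r ∈ K,
      ‖(fderiv ℝ Φ (r, y)).comp (ContinuousLinearMap.inl ℝ P E)‖ ≤ max C₀ 0 := by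
    intro r hr
    refine (ContinuousLinearMap.opNorm_comp_le _ _).trans ?_
    have h1 : ‖fderiv ℝ Φ (r, y)‖ ≤ max C₀ 0 := (hC₀ (r, y) (mk_mem_prod hr hy)).trans (le_max_left _ _)
    calc ‖fderiv ℝ Φ (r, y)‖ * ‖ContinuousLinearMap.inl ℝ P E‖ ≤ max C₀ 0 * 1 :=
          mul_le_mul h1 (ContinuousLinearMap.norm_inl_le_one ℝ P E) (norm_nonneg _)
            (le_max_right _ _)
      _ = max C₀ 0 := mul_one _
  exact hKc.norm_image_sub_le_of_norm_hasFDerivWithin_le hderiv hbound hp hp'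

/-- **Iterated derivatives in `y` are Lipschitz in the parameter, uniformly** (all orders `i ≤ k`
at once): for `F : P × E → G` smooth at every point of an open `U ⊇ K × L` (`K` convex compact,
`L` compact) there is `C ≥ 0` with
`‖Dⁱ[F(p', ·)](y) − Dⁱ[F(p, ·)](y)‖ ≤ C ‖p' − p‖` for `i ≤ k`, `p, p' ∈ K`, `y ∈ L`.
Dieudonné 1960, (8.5.4), (8.12.6). [folklore] -/
theorem exists_norm_iteratedFDeriv_sub_le_parametric {F : P × E → G} {U : Set (P × E)}
    (hU : IsOpen U) (hF : ∀ q ∈ U, ContDiffAt ℝ ∞ F q) {K : Set P} (hK : IsCompact K)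
    (hKc : Convex ℝ K) {L : Set E} (hL : IsCompact L) (hKL : K ×ˢ L ⊆ U) (k : ℕ) :
    ∃ C : ℝ, 0 ≤ C ∧ ∀ i ≤ k, ∀ p ∈ K, ∀ p' ∈ K, ∀ y ∈ L,
      ‖iteratedFDeriv ℝ i (fun z ↦ F (p', z)) y - iteratedFDeriv ℝ i (fun z ↦ F (p, z)) y‖ ≤
        C * ‖p' - p‖ := by
  -- one constant per order, then the maximum over `i ≤ k`
  have hi : ∀ i : ℕ, ∃ C : ℝ, 0 ≤ C ∧ ∀ p ∈ K, ∀ p' ∈ K, ∀ y ∈ L,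
      ‖iteratedFDeriv ℝ i (fun z ↦ F (p', z)) y - iteratedFDeriv ℝ i (fun z ↦ F (p, z)) y‖ ≤
        C * ‖p' - p‖ := fun i ↦ by
    have hΦ : ContDiffOn ℝ 1 (fun q : P × E ↦ iteratedFDeriv ℝ i (fun z ↦ F (q.1, z)) q.2) U :=
      fun q hq ↦ ((contDiffAt_iteratedFDeriv_parametric hF i q hq).of_le
        (by exact_mod_cast le_top)).contDiffWithinAt
    exact exists_norm_sub_le_mul_norm_sub_of_contDiffOn hU hΦ hK hKc hL hKL
  induction k with
  | zero =>
    obtain ⟨C, hC0, hC⟩ := hi 0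
    exact ⟨C, hC0, fun i hi0 p hp p' hp' y hy ↦ by rw [Nat.le_zero.1 hi0]; exact hC p hp p' hp' y hy⟩
  | succ k ih =>
    obtain ⟨C, hC0, hC⟩ := ih
    obtain ⟨C', hC0', hC'⟩ := hi (k + 1)
    refine ⟨max C C', le_max_of_le_left hC0, fun i hik p hp p' hp' y hy ↦ ?_⟩
    rcases Nat.of_le_succ hik with h | h
    · exact (hC i h p hp p' hp' y hy).trans
        (mul_le_mul_of_nonneg_right (le_max_left _ _) (norm_nonneg _))
    · rw [h]
      exact (hC' p hp p' hp' y hy).trans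
        (mul_le_mul_of_nonneg_right (le_max_right _ _) (norm_nonneg _))

/-- **`C^k` smallness of a smooth family near a member that vanishes**: if moreover
`F(p₀, ·) = 0` near every point of `L` for some `p₀ ∈ K`, then
`‖Dⁱ[F(p, ·)](y)‖ ≤ C ‖p − p₀‖` for all `i ≤ k`, `p ∈ K`, `y ∈ L`. (The shape of the estimate
"`‖ḡ_{m,a} − ḡ_{m₀}‖_{C^k} ≤ C(|m − m₀| + |a|)`" for explicit smooth families of tensors, e.g.
Li–Mei arXiv:2005.01249, p. 22.) [folklore] -/
theorem exists_norm_iteratedFDeriv_le_parametric_of_eq_zero {F : P × E → G} {U : Set (P × E)}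
    (hU : IsOpen U) (hF : ∀ q ∈ U, ContDiffAt ℝ ∞ F q) {K : Set P} (hK : IsCompact K)
    (hKc : Convex ℝ K) {L : Set E} (hL : IsCompact L) (hKL : K ×ˢ L ⊆ U) {p₀ : P} (hp₀ : p₀ ∈ K)
    (h0 : ∀ y ∈ L, (fun z ↦ F (p₀, z)) =ᶠ[𝓝 y] fun _ ↦ 0) (k : ℕ) :
    ∃ C : ℝ, 0 ≤ C ∧ ∀ i ≤ k, ∀ p ∈ K, ∀ y ∈ L,
      ‖iteratedFDeriv ℝ i (fun z ↦ F (p, z)) y‖ ≤ C * ‖p - p₀‖ := by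
  obtain ⟨C, hC0, hC⟩ := exists_norm_iteratedFDeriv_sub_le_parametric hU hF hK hKc hL hKL k
  refine ⟨C, hC0, fun i hi p hp y hy ↦ ?_⟩
  have hz : iteratedFDeriv ℝ i (fun z ↦ F (p₀, z)) y = 0 := by
    rw [((h0 y hy).iteratedFDeriv ℝ i).eq_of_nhds, iteratedFDeriv_fun_zero, Pi.zero_apply]
  have h := hC i hi p₀ hp₀ p hp y hy
  rwa [hz, sub_zero] at h

end Literature.Analysis.Calculus

end
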